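import Literature.NumberTheory.Automorphic.SeesawTorus
import Literature.NumberTheory.Automorphic.UnitaryLineCharacters
import HarnessLib

/-!
# Characters of the seesaw torus `[T] = [U(W₁)] × [U(W₂)]` and their archimedean types

Topic `NumberTheory/Automorphic`; namespace `Literature.NumberTheory.Automorphic` (sub-namespaces `SeesawArchTorus`,
`SeesawTorus`).  For a CM field `L` with maximal totally real subfield `L⁺` and the seesaw torus `T = U(W₁) × U(W₂)`
of two hermitian lines over `L/L⁺` (file `SeesawTorus`):
* § 1 the archimedean torus `T(L⁺ ⊗ ℝ) = U(W₁)(L⁺ ⊗ ℝ) × U(W₂)(L⁺ ⊗ ℝ)` (`SeesawArchTorus L`, compact), its embedding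
  `ιc : T(L⁺ ⊗ ℝ) →* T(𝔸)` (`SeesawArchTorus.toAdeles`) and `cl = π ∘ ιc : T(L⁺ ⊗ ℝ) → [T]` (`SeesawArchTorus.toQuot`);
* § 2 the typed weight `w(m₁, m₂) = archWeight m₁ ⊠ archWeight m₂ : T(L⁺ ⊗ ℝ) →* S¹ ⊂ ℂ`
  (`SeesawArchTorus.weightCircle`, `SeesawArchTorus.weight`);
* § 3 characters of `[T]`: the components `χ′₁ := ξ|_{[U(W₁)]}`, `χ′₂ := ξ|_{[U(W₂)]}`, the external product
  `χ′₁ ⊠ χ′₂`, and **`(continuous unitary characters of [T]) ≃* (pairs of characters of [U(W₁)], [U(W₂)])`**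
  (`SeesawTorus.charEquiv`);
* § 4 the type condition: `ξ ∘ cl = w(m₁, m₂)` **iff** `χ′_j` has archimedean type `m_j` (`j = 1, 2`)
  (`SeesawTorus.hasArchType_iff_charFst_charSnd`), and — from `exists_unitaryLineChar_hasArchType` — **for every pair of
  types `(m₁, m₂)` there is a character of `[T]` of that type** (`SeesawTorus.exists_char_hasArchType`).

Everything is proved (Mathlib + tree); no named facts.  Port of the HodgeCM publication cell's `PerL34/SeesawTorus`
§§ 6–8 (2026-08-18).  References: A. Weil, *Basic Number Theory* (1967), Ch. VII § 3 [cite: WeilBNT1967, Ch. VII §3];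
V. Platonov, A. Rapinchuk, *Algebraic Groups and Number Theory* (1994), § 5.3 [cite: PlatonovRapinchuk1994, §5.3].
-/

set_option autoImplicit false

noncomputable section

open _root_.MeasureTheory _root_.Topology _root_.Set _root_.Function
open NumberField IsDedekindDomain InfinitePlace

namespace Literature.NumberTheory.Automorphic

/-! ## § 1. `T(L⁺ ⊗ ℝ) = U(W₁)(L⁺ ⊗ ℝ) × U(W₂)(L⁺ ⊗ ℝ)`, `ιc` and `cl` -/

/-- **`T(L⁺ ⊗ ℝ)`** for the CM extension `L/L⁺`: the product of two copies of the archimedean torus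
`U(W_j)(L⁺ ⊗ ℝ) = relNormOneInfUnits L⁺ L ≅ ∏_{w ∣ ∞} U(1)`, a type synonym with the Borel σ-algebra. [folklore] -/
def SeesawArchTorus (L : Type) [Field L] [NumberField L] : Type :=
  relNormOneInfUnits (maximalRealSubfield L) L × relNormOneInfUnits (maximalRealSubfield L) L

namespace SeesawArchTorus

variable (L : Type) [Field L] [NumberField L]

local notation "L⁺" => maximalRealSubfield L

/-- Structure transported from the product (instance). [folklore] -/
instance instCommGroup : CommGroup (SeesawArchTorus L) :=
  inferInstanceAs (CommGroup (relNormOneInfUnits L⁺ L × relNormOneInfUnits L⁺ L))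

/-- Structure transported from the product (instance). [folklore] -/
instance instTopologicalSpace : TopologicalSpace (SeesawArchTorus L) :=
  inferInstanceAs (TopologicalSpace (relNormOneInfUnits L⁺ L × relNormOneInfUnits L⁺ L))

/-- Structure transported from the product (instance). [folklore] -/
instance instIsTopologicalGroup : IsTopologicalGroup (SeesawArchTorus L) :=
  inferInstanceAs (IsTopologicalGroup (relNormOneInfUnits L⁺ L × relNormOneInfUnits L⁺ L))

/-- Structure transported from the product (instance). [folklore] -/
instance instT2Space : T2Space (SeesawArchTorus L) :=
  inferInstanceAs (T2Space (relNormOneInfUnits L⁺ L × relNormOneInfUnits L⁺ L))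

/-- `T(L⁺ ⊗ ℝ)` is compact (`L` CM). [folklore] -/
instance instCompactSpace [IsCMField L] : CompactSpace (SeesawArchTorus L) :=
  inferInstanceAs (CompactSpace (relNormOneInfUnits L⁺ L × relNormOneInfUnits L⁺ L))

/-- Structure transported from the product (instance). [folklore] -/
instance instMeasurableSpace : MeasurableSpace (SeesawArchTorus L) := borel _

/-- Structure transported from the product (instance). [folklore] -/
instance instBorelSpace : BorelSpace (SeesawArchTorus L) := ⟨rfl⟩

/-- Structure transported from the product (instance). [folklore] -/
instance instNonempty : Nonempty (SeesawArchTorus L) := ⟨1⟩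

/-- `(t₁, t₂) ∈ T(L⁺ ⊗ ℝ)`. [folklore] -/
def mk (t₁ t₂ : relNormOneInfUnits L⁺ L) : SeesawArchTorus L := (t₁, t₂)

/-- The two projections and the two inclusions. [folklore] -/
def fst : SeesawArchTorus L →* relNormOneInfUnits L⁺ L := MonoidHom.fst _ _
/-- `snd`. [folklore] -/
def snd : SeesawArchTorus L →* relNormOneInfUnits L⁺ L := MonoidHom.snd _ _
/-- `inl`. [folklore] -/
def inl : relNormOneInfUnits L⁺ L →* SeesawArchTorus L := MonoidHom.inl _ _
/-- `inr`. [folklore] -/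
def inr : relNormOneInfUnits L⁺ L →* SeesawArchTorus L := MonoidHom.inr _ _

variable {L}

/-- Evaluation rule for `fst_mk` (definitional up to the group laws). [folklore] -/
@[simp] theorem fst_mk (t₁ t₂ : relNormOneInfUnits L⁺ L) : fst L (mk L t₁ t₂) = t₁ := rfl
/-- Evaluation rule for `snd_mk` (definitional up to the group laws). [folklore] -/
@[simp] theorem snd_mk (t₁ t₂ : relNormOneInfUnits L⁺ L) : snd L (mk L t₁ t₂) = t₂ := rfl

variable (L)

/-- **`ιc : T(L⁺ ⊗ ℝ) →* T(𝔸)`**, the archimedean components (`relNormOneInfToIdeles` on each factor). [folklore] -/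
def toAdeles : SeesawArchTorus L →* SeesawTorus L⁺ L :=
  MonoidHom.prodMap (relNormOneInfToIdeles L⁺ L) (relNormOneInfToIdeles L⁺ L)

variable {L} in
/-- Evaluation rule for `fst_toAdeles` (definitional up to the group laws). [folklore] -/
@[simp] theorem fst_toAdeles (t : SeesawArchTorus L) :
    SeesawTorus.fst L⁺ L (toAdeles L t) = relNormOneInfToIdeles L⁺ L (fst L t) := rfl
variable {L} in
/-- Evaluation rule for `snd_toAdeles` (definitional up to the group laws). [folklore] -/
@[simp] theorem snd_toAdeles (t : SeesawArchTorus L) :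
    SeesawTorus.snd L⁺ L (toAdeles L t) = relNormOneInfToIdeles L⁺ L (snd L t) := rfl

/-- Continuity of `toAdeles`. [folklore] -/
theorem continuous_toAdeles : Continuous (toAdeles L) :=
  ((continuous_relNormOneInfToIdeles L⁺ L).comp _root_.continuous_fst).prodMk
    ((continuous_relNormOneInfToIdeles L⁺ L).comp _root_.continuous_snd)

/-- Injectivity of `toAdeles`. [folklore] -/
theorem toAdeles_injective : Injective (toAdeles L) := by
  intro a b h
  exact Prod.ext (relNormOneInfToIdeles_injective L⁺ L (congrArg (SeesawTorus.fst L⁺ L) h))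
    (relNormOneInfToIdeles_injective L⁺ L (congrArg (SeesawTorus.snd L⁺ L) h))

/-- **`cl = π ∘ ιc : T(L⁺ ⊗ ℝ) → [T]`**. [folklore] -/
def toQuot : SeesawArchTorus L →* SeesawTorus L⁺ L ⧸ SeesawTorus.rat L⁺ L :=
  (QuotientGroup.mk' _).comp (toAdeles L)

variable {L} in
/-- Evaluation rule for `toQuot_apply` (definitional up to the group laws). [folklore] -/
theorem toQuot_apply (t : SeesawArchTorus L) : toQuot L t = QuotientGroup.mk (toAdeles L t) := rfl

/-- Continuity of `toQuot`. [folklore] -/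
theorem continuous_toQuot : Continuous (toQuot L) := QuotientGroup.continuous_mk.comp (continuous_toAdeles L)

variable {L} in
/-- `quotFst_toQuot`. [folklore] -/
@[simp] theorem quotFst_toQuot (t : SeesawArchTorus L) :
    SeesawTorus.quotFst L⁺ L (toQuot L t) = relNormOneInfToQuot L⁺ L (fst L t) := rfl
variable {L} in
/-- `quotSnd_toQuot`. [folklore] -/
@[simp] theorem quotSnd_toQuot (t : SeesawArchTorus L) :
    SeesawTorus.quotSnd L⁺ L (toQuot L t) = relNormOneInfToQuot L⁺ L (snd L t) := rfl

variable {L} in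
/-- Evaluation rule for `toQuot_inl` (definitional up to the group laws). [folklore] -/
theorem toQuot_inl (t : relNormOneInfUnits L⁺ L) :
    toQuot L (inl L t) = SeesawTorus.quotInl L⁺ L (relNormOneInfToQuot L⁺ L t) := by
  have h : toAdeles L (inl L t) = SeesawTorus.inl L⁺ L (relNormOneInfToIdeles L⁺ L t) :=
    Prod.ext rfl (by change relNormOneInfToIdeles L⁺ L 1 = 1; exact map_one _)
  rw [toQuot_apply, h, relNormOneInfToQuot_apply, SeesawTorus.quotInl_mk]

variable {L} in
/-- Evaluation rule for `toQuot_inr` (definitional up to the group laws). [folklore] -/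
theorem toQuot_inr (t : relNormOneInfUnits L⁺ L) :
    toQuot L (inr L t) = SeesawTorus.quotInr L⁺ L (relNormOneInfToQuot L⁺ L t) := by
  have h : toAdeles L (inr L t) = SeesawTorus.inr L⁺ L (relNormOneInfToIdeles L⁺ L t) :=
    Prod.ext (by change relNormOneInfToIdeles L⁺ L 1 = 1; exact map_one _) rfl
  rw [toQuot_apply, h, relNormOneInfToQuot_apply, SeesawTorus.quotInr_mk]

/-! ## § 2. The typed weight `w(m₁, m₂) = archWeight m₁ ⊠ archWeight m₂` of `T(L⁺ ⊗ ℝ)` -/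

variable [IsCMField L]

/-- **The weight of type `(m₁, m₂)`**, circle-valued: `(t₁, t₂) ↦ archWeightCircle m₁ t₁ · archWeightCircle m₂ t₂`.
[folklore] -/
def weightCircle (m₁ m₂ : InfinitePlace L → ℤ) : SeesawArchTorus L →* Circle :=
  MonoidHom.coprod (archWeightCircle L m₁) (archWeightCircle L m₂)

variable {L} in
/-- Evaluation rule for `weightCircle_apply` (definitional up to the group laws). [folklore] -/
theorem weightCircle_apply (m₁ m₂ : InfinitePlace L → ℤ) (t : SeesawArchTorus L) :
    weightCircle L m₁ m₂ t = archWeightCircle L m₁ (fst L t) * archWeightCircle L m₂ (snd L t) := rfl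

/-- Continuity of `weightCircle`. [folklore] -/
theorem continuous_weightCircle (m₁ m₂ : InfinitePlace L → ℤ) : Continuous (weightCircle L m₁ m₂) :=
  ((continuous_archWeightCircle L m₁).comp _root_.continuous_fst).mul
    ((continuous_archWeightCircle L m₂).comp _root_.continuous_snd)

/-- **The weight `w(m₁, m₂) : T(L⁺ ⊗ ℝ) →* ℂ`** — the archimedean component `χ′_{1,∞} ⊠ χ′_{2,∞}` of a character
`χ′₁ ⊠ χ′₂` of types `(m₁, m₂)`. [folklore] -/
def weight (m₁ m₂ : InfinitePlace L → ℤ) : SeesawArchTorus L →* ℂ :=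
  MonoidHom.coprod (archWeight L m₁) (archWeight L m₂)

variable {L} in
/-- Evaluation rule for `weight_apply` (definitional up to the group laws). [folklore] -/
theorem weight_apply (m₁ m₂ : InfinitePlace L → ℤ) (t : SeesawArchTorus L) :
    weight L m₁ m₂ t = archWeight L m₁ (fst L t) * archWeight L m₂ (snd L t) := rfl

variable {L} in
/-- `weight_eq_coe_weightCircle`. [folklore] -/
theorem weight_eq_coe_weightCircle (m₁ m₂ : InfinitePlace L → ℤ) (t : SeesawArchTorus L) :
    weight L m₁ m₂ t = ((weightCircle L m₁ m₂ t : Circle) : ℂ) := by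
  rw [weight_apply, weightCircle_apply, Circle.coe_mul, archWeight_apply, archWeight_apply]

variable {L} in
/-- Evaluation rule for `weight_inl` (definitional up to the group laws). [folklore] -/
@[simp] theorem weight_inl (m₁ m₂ : InfinitePlace L → ℤ) (t : relNormOneInfUnits L⁺ L) :
    weight L m₁ m₂ (inl L t) = archWeight L m₁ t := by
  rw [weight_apply]; change archWeight L m₁ t * archWeight L m₂ 1 = _; rw [map_one, mul_one]

variable {L} in
/-- Evaluation rule for `weight_inr` (definitional up to the group laws). [folklore] -/
@[simp] theorem weight_inr (m₁ m₂ : InfinitePlace L → ℤ) (t : relNormOneInfUnits L⁺ L) :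
    weight L m₁ m₂ (inr L t) = archWeight L m₂ t := by
  rw [weight_apply]; change archWeight L m₁ 1 * archWeight L m₂ t = _; rw [map_one, one_mul]

/-- `w` is unitary … [folklore] -/
theorem norm_weight (m₁ m₂ : InfinitePlace L → ℤ) (t : SeesawArchTorus L) : ‖weight L m₁ m₂ t‖ = 1 := by
  rw [weight_apply, norm_mul, norm_archWeight, norm_archWeight, mul_one]

/-- … and continuous. [folklore] -/
theorem continuous_weight (m₁ m₂ : InfinitePlace L → ℤ) : Continuous (weight L m₁ m₂) :=
  ((continuous_archWeight L m₁).comp _root_.continuous_fst).mul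
    ((continuous_archWeight L m₂).comp _root_.continuous_snd)

end SeesawArchTorus

/-! ## § 3. Characters of `[T]`: `ξ = (χ′₁, χ′₂)`, `χ′₁ ⊠ χ′₂`, `charEquiv` -/

namespace SeesawTorus

section Characters

variable (K L : Type) [Field K] [Field L] [NumberField L] [Algebra K L] [FiniteDimensional K L]

/-- The four structure maps `[T] ⇄ [U(W_j)]` as continuous homomorphisms. [folklore] -/
def quotFstC : ContinuousMonoidHom (SeesawTorus K L ⧸ rat K L) (relNormOneIdeles K L ⧸ relNormOneRat K L) :=
  { quotFst K L with continuous_toFun := continuous_quotFst K L }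
/-- `quotSndC`. [folklore] -/
def quotSndC : ContinuousMonoidHom (SeesawTorus K L ⧸ rat K L) (relNormOneIdeles K L ⧸ relNormOneRat K L) :=
  { quotSnd K L with continuous_toFun := continuous_quotSnd K L }
/-- `quotInlC`. [folklore] -/
def quotInlC : ContinuousMonoidHom (relNormOneIdeles K L ⧸ relNormOneRat K L) (SeesawTorus K L ⧸ rat K L) :=
  { quotInl K L with continuous_toFun := continuous_quotInl K L }
/-- `quotInrC`. [folklore] -/
def quotInrC : ContinuousMonoidHom (relNormOneIdeles K L ⧸ relNormOneRat K L) (SeesawTorus K L ⧸ rat K L) :=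
  { quotInr K L with continuous_toFun := continuous_quotInr K L }

variable {K L}

/-- **`χ′₁ := ξ|_{[U(W₁)]}`**, the first component of a continuous unitary character `ξ` of `[T]`. [folklore] -/
def charFst (ξ : ContinuousMonoidHom (SeesawTorus K L ⧸ rat K L) Circle) :
    ContinuousMonoidHom (relNormOneIdeles K L ⧸ relNormOneRat K L) Circle :=
  ξ.comp (quotInlC K L)

/-- **`χ′₂ := ξ|_{[U(W₂)]}`**, the second component. [folklore] -/
def charSnd (ξ : ContinuousMonoidHom (SeesawTorus K L ⧸ rat K L) Circle) :
    ContinuousMonoidHom (relNormOneIdeles K L ⧸ relNormOneRat K L) Circle :=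
  ξ.comp (quotInrC K L)

/-- **`χ′₁ ⊠ χ′₂`**, the character `(u₁, u₂) ↦ χ′₁(u₁) χ′₂(u₂)` of `[T]`. [folklore] -/
def charPair (ξ₁ ξ₂ : ContinuousMonoidHom (relNormOneIdeles K L ⧸ relNormOneRat K L) Circle) :
    ContinuousMonoidHom (SeesawTorus K L ⧸ rat K L) Circle :=
  ξ₁.comp (quotFstC K L) * ξ₂.comp (quotSndC K L)

/-- Evaluation rule for `charFst_apply` (definitional up to the group laws). [folklore] -/
@[simp] theorem charFst_apply (ξ : ContinuousMonoidHom (SeesawTorus K L ⧸ rat K L) Circle)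
    (q : relNormOneIdeles K L ⧸ relNormOneRat K L) : charFst ξ q = ξ (quotInl K L q) := rfl

/-- Evaluation rule for `charSnd_apply` (definitional up to the group laws). [folklore] -/
@[simp] theorem charSnd_apply (ξ : ContinuousMonoidHom (SeesawTorus K L ⧸ rat K L) Circle)
    (q : relNormOneIdeles K L ⧸ relNormOneRat K L) : charSnd ξ q = ξ (quotInr K L q) := rfl

/-- Evaluation rule for `charPair_apply` (definitional up to the group laws). [folklore] -/
@[simp] theorem charPair_apply (ξ₁ ξ₂ : ContinuousMonoidHom (relNormOneIdeles K L ⧸ relNormOneRat K L) Circle)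
    (q : SeesawTorus K L ⧸ rat K L) : charPair ξ₁ ξ₂ q = ξ₁ (quotFst K L q) * ξ₂ (quotSnd K L q) := rfl

/-- **Every character of `[T]` factors**: `ξ(u₁, u₂) = χ′₁(u₁) χ′₂(u₂)` with `(χ′₁, χ′₂) := ξ`. [folklore] -/
theorem char_apply_eq (ξ : ContinuousMonoidHom (SeesawTorus K L ⧸ rat K L) Circle) (q : SeesawTorus K L ⧸ rat K L) :
    ξ q = charFst ξ (quotFst K L q) * charSnd ξ (quotSnd K L q) := by
  rw [charFst_apply, charSnd_apply, ← map_mul, quotInl_quotFst_mul_quotInr_quotSnd]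

/-- `charPair_charFst_charSnd`. [folklore] -/
@[simp] theorem charPair_charFst_charSnd (ξ : ContinuousMonoidHom (SeesawTorus K L ⧸ rat K L) Circle) :
    charPair (charFst ξ) (charSnd ξ) = ξ :=
  ContinuousMonoidHom.ext fun q => (char_apply_eq ξ q).symm

/-- Evaluation rule for `charFst_charPair_apply` (definitional up to the group laws). [folklore] -/
theorem charFst_charPair_apply (ξ₁ ξ₂ : ContinuousMonoidHom (relNormOneIdeles K L ⧸ relNormOneRat K L) Circle)
    (q : relNormOneIdeles K L ⧸ relNormOneRat K L) : charFst (charPair ξ₁ ξ₂) q = ξ₁ q := by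
  rw [charFst_apply, charPair_apply, quotFst_quotInl, quotSnd_quotInl, map_one, mul_one]

/-- Evaluation rule for `charSnd_charPair_apply` (definitional up to the group laws). [folklore] -/
theorem charSnd_charPair_apply (ξ₁ ξ₂ : ContinuousMonoidHom (relNormOneIdeles K L ⧸ relNormOneRat K L) Circle)
    (q : relNormOneIdeles K L ⧸ relNormOneRat K L) : charSnd (charPair ξ₁ ξ₂) q = ξ₂ q := by
  rw [charSnd_apply, charPair_apply, quotFst_quotInr, quotSnd_quotInr, map_one, one_mul]

/-- `charFst_charPair`. [folklore] -/
@[simp] theorem charFst_charPair (ξ₁ ξ₂ : ContinuousMonoidHom (relNormOneIdeles K L ⧸ relNormOneRat K L) Circle) :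
    charFst (charPair ξ₁ ξ₂) = ξ₁ :=
  ContinuousMonoidHom.ext fun q => charFst_charPair_apply ξ₁ ξ₂ q

/-- `charSnd_charPair`. [folklore] -/
@[simp] theorem charSnd_charPair (ξ₁ ξ₂ : ContinuousMonoidHom (relNormOneIdeles K L ⧸ relNormOneRat K L) Circle) :
    charSnd (charPair ξ₁ ξ₂) = ξ₂ :=
  ContinuousMonoidHom.ext fun q => charSnd_charPair_apply ξ₁ ξ₂ q

/-- Multiplicativity (`charFst_mul`). [folklore] -/
theorem charFst_mul (ξ η : ContinuousMonoidHom (SeesawTorus K L ⧸ rat K L) Circle) :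
    charFst (ξ * η) = charFst ξ * charFst η := rfl
/-- Multiplicativity (`charSnd_mul`). [folklore] -/
theorem charSnd_mul (ξ η : ContinuousMonoidHom (SeesawTorus K L ⧸ rat K L) Circle) :
    charSnd (ξ * η) = charSnd ξ * charSnd η := rfl

variable (K L) in
/-- **`(χ′₁, χ′₂) := ξ`**: the continuous unitary characters of `[T]` ARE the pairs of characters of `[U(W₁)]`,
`[U(W₂)]` — a group isomorphism with inverse `χ′₁ ⊠ χ′₂`. [folklore] -/
def charEquiv : ContinuousMonoidHom (SeesawTorus K L ⧸ rat K L) Circle ≃*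
    ContinuousMonoidHom (relNormOneIdeles K L ⧸ relNormOneRat K L) Circle ×
      ContinuousMonoidHom (relNormOneIdeles K L ⧸ relNormOneRat K L) Circle where
  toFun ξ := (charFst ξ, charSnd ξ)
  invFun p := charPair p.1 p.2
  left_inv ξ := charPair_charFst_charSnd ξ
  right_inv p := Prod.ext (charFst_charPair p.1 p.2) (charSnd_charPair p.1 p.2)
  map_mul' ξ η := Prod.ext (charFst_mul ξ η) (charSnd_mul ξ η)

/-- Evaluation rule for `charEquiv_apply` (definitional up to the group laws). [folklore] -/
@[simp] theorem charEquiv_apply (ξ : ContinuousMonoidHom (SeesawTorus K L ⧸ rat K L) Circle) :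
    charEquiv K L ξ = (charFst ξ, charSnd ξ) := rfl

end Characters

/-! ## § 4. The type condition `ξ ∘ cl = w(m₁, m₂)` and characters of every type -/

section Types

variable (L : Type) [Field L] [NumberField L] [IsCMField L]

local notation "L⁺" => maximalRealSubfield L

/-- "`ξ` has archimedean type `(m₁, m₂)`": `ξ (cl t) = w(m₁, m₂)(t)` for every `t ∈ T(L⁺ ⊗ ℝ)`. [folklore] -/
def HasArchType (ξ : ContinuousMonoidHom (SeesawTorus L⁺ L ⧸ rat L⁺ L) Circle) (m₁ m₂ : InfinitePlace L → ℤ) :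
    Prop :=
  ∀ t : SeesawArchTorus L, ξ (SeesawArchTorus.toQuot L t) = SeesawArchTorus.weightCircle L m₁ m₂ t

variable {L}

/-- The type condition read in `ℂ`. [folklore] -/
theorem hasArchType_iff_weight (ξ : ContinuousMonoidHom (SeesawTorus L⁺ L ⧸ rat L⁺ L) Circle)
    (m₁ m₂ : InfinitePlace L → ℤ) :
    HasArchType L ξ m₁ m₂ ↔
      ∀ t : SeesawArchTorus L, ((ξ (SeesawArchTorus.toQuot L t) : Circle) : ℂ) = SeesawArchTorus.weight L m₁ m₂ t := by
  refine forall_congr' fun t => ?_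
  rw [SeesawArchTorus.weight_eq_coe_weightCircle]
  exact ⟨fun h => congrArg _ h, fun h => Circle.ext h⟩

/-- **The type condition splits**: `ξ` has type `(m₁, m₂)` **iff** `χ′₁ := ξ|_{[U(W₁)]}` has archimedean type `m₁`
**and** `χ′₂ := ξ|_{[U(W₂)]}` has archimedean type `m₂`. [folklore] -/
theorem hasArchType_iff_charFst_charSnd (ξ : ContinuousMonoidHom (SeesawTorus L⁺ L ⧸ rat L⁺ L) Circle)
    (m₁ m₂ : InfinitePlace L → ℤ) :
    HasArchType L ξ m₁ m₂ ↔
      UnitaryLineChar.HasArchType L (charFst ξ) m₁ ∧ UnitaryLineChar.HasArchType L (charSnd ξ) m₂ := by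
  constructor
  · intro h
    refine ⟨fun t => ?_, fun t => ?_⟩
    · rw [charFst_apply, ← SeesawArchTorus.toQuot_inl, h, SeesawArchTorus.weightCircle_apply]
      change archWeightCircle L m₁ t * archWeightCircle L m₂ 1 = _
      rw [map_one, mul_one]
    · rw [charSnd_apply, ← SeesawArchTorus.toQuot_inr, h, SeesawArchTorus.weightCircle_apply]
      change archWeightCircle L m₁ 1 * archWeightCircle L m₂ t = _
      rw [map_one, one_mul]
  · rintro ⟨h₁, h₂⟩ t
    rw [char_apply_eq ξ, SeesawArchTorus.quotFst_toQuot, SeesawArchTorus.quotSnd_toQuot,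
      SeesawArchTorus.weightCircle_apply, h₁, h₂]

/-- The same for a character given as a pair: `χ′₁ ⊠ χ′₂` has type `(m₁, m₂)` iff `χ′_j` has type `m_j`.
[folklore] -/
theorem hasArchType_charPair_iff (ξ₁ ξ₂ : ContinuousMonoidHom (relNormOneIdeles L⁺ L ⧸ relNormOneRat L⁺ L) Circle)
    (m₁ m₂ : InfinitePlace L → ℤ) :
    HasArchType L (charPair ξ₁ ξ₂) m₁ m₂ ↔
      UnitaryLineChar.HasArchType L ξ₁ m₁ ∧ UnitaryLineChar.HasArchType L ξ₂ m₂ := by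
  rw [hasArchType_iff_charFst_charSnd, charFst_charPair, charSnd_charPair]

/-- Types multiply. [folklore] -/
theorem HasArchType.mul {ξ ξ' : ContinuousMonoidHom (SeesawTorus L⁺ L ⧸ rat L⁺ L) Circle}
    {m₁ m₂ m₁' m₂' : InfinitePlace L → ℤ} (h : HasArchType L ξ m₁ m₂) (h' : HasArchType L ξ' m₁' m₂') :
    HasArchType L (ξ * ξ') (m₁ + m₁') (m₂ + m₂') := by
  rw [hasArchType_iff_charFst_charSnd] at h h' ⊢
  rw [charFst_mul, charSnd_mul]
  exact ⟨h.1.mul L h'.1, h.2.mul L h'.2⟩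

variable (L)

/-- **Characters of `[T]` of every archimedean type.**  For every pair `(m₁, m₂)` of archimedean types there is a
continuous unitary character `ξ = χ′₁ ⊠ χ′₂` of `[T] = T(L⁺) \ T(𝔸)` with `ξ ∘ cl = w(m₁, m₂)`.
[cite: WeilBNT1967, Ch. VII §3] -/
theorem exists_char_hasArchType (m₁ m₂ : InfinitePlace L → ℤ) :
    ∃ ξ : ContinuousMonoidHom (SeesawTorus L⁺ L ⧸ rat L⁺ L) Circle, HasArchType L ξ m₁ m₂ := by
  obtain ⟨χ₁, h₁⟩ := exists_unitaryLineChar_hasArchType L m₁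
  obtain ⟨χ₂, h₂⟩ := exists_unitaryLineChar_hasArchType L m₂
  exact ⟨charPair χ₁ χ₂, (hasArchType_charPair_iff χ₁ χ₂ m₁ m₂).mpr ⟨h₁, h₂⟩⟩


end Types

end SeesawTorus

end Literature.NumberTheory.Automorphic

end
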